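import Summits.ValiantsHypothesis.ValiantsHypothesis.Theorems.FreeSubtorusOrbitDimensionBoundStubPerSummandPrelimC

/-!
# `OrbitDimensionBound` (stmt-ValiantsHypothesis-16133), rung line `square_covering` — stub `stub_stableReduction`,
# infrastructure: Fitting's lemma for determinant a PRIME POWER

First helper file toward stub 1 `stub_stableReduction` of `Cruxes/OrbitDimensionBound/Lines/square_covering.lean`
(route `FreeSubtorus`): the line's «UFD descent» (keep a block carrying a positive power of `per_n` and recurse on
the size) in the Kronecker-module form used by this seat's Krull–Schmidt toolkit (`…StubPerSummandPrelimA/B/C`).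

* **`exists_local_retract_pow`** — an affine square matrix `M` over `ℂ[x_σ]` with `det M = c · f^k` (`f` prime,
  `c ≠ 0`, `k ≥ 1`) has an affine LOCAL retract `N` (every endomorphism pair `g N = N h` is `μ + nilpotent`) of size
  `≤` that of `M` with `det N = c' · f^j` for some `1 ≤ j ≤ k` (retract maps `v_W N = M v_V`, `u_W M = N u_V`,
  `u v = 1`).  Proof: the induction of `exists_local_retract` (graded square form of a non-local endomorphism pair,
  two diagonal blocks), with `dvd_prime_pow` deciding which block keeps a positive power of `f`.

What remains for `stub_stableReduction` (NOT here; plan in HOME/lmr/NOTE-p4g12-16133-stableReduction-plan.md): (i) the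
multi-summand Krull–Schmidt exchange making the local retract equivariant under a DIVISIBLE torus (`T_{Λ'}`, `Λ'` the
Smith saturation of `…StubDiagonalLifts`) by the orbit argument `δ^{k!} N ≅ N`; (ii) for a local but not stable `N`, the
lift-stable SOCLE (sum of minimal equal-dimension sub-pencils) splits `N` block-triangularly into equivariant blocks.

Helper mode (`--supports stmt-ValiantsHypothesis-16133 --as helper`).  Honest framing: [folklore] algebra toward ONE
registered stub of a dormant rung line whose core `stub_gradedPowerCount` is OPEN; `OrbitDimensionBound`,
`FreeSubtorus` and VP ≠ VNP are OPEN and not moved.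

## References
* N. Jacobson, *Basic Algebra II*, 2nd ed. (1989), §3.4 (Fitting, Krull–Schmidt) — orientation only.
* [LandsbergRessayre2017] J. M. Landsberg, N. Ressayre, Differential Geom. Appl. 55 (2017), §3.3.
-/

set_option linter.dupNamespace false

namespace Summit.ValiantsHypothesis.ValiantsHypothesis.Theorems.FreeSubtorusOrbitDimensionBound.SquareCovering

open Matrix MvPolynomial Finset Module.End
open Literature.Computability.AlgebraicComplexity
open Summit.ValiantsHypothesis.ValiantsHypothesis.Theorems.FreeSubtorusConfusionCovering
open Summit.ValiantsHypothesis.ValiantsHypothesis.Theorems.FreeSubtorusOrbitDimensionBound.SignCovering.PerSummand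

section Pow

variable {σ : Type*}

/-- A divisor of `c · f^k` (`f` prime, `c ≠ 0`) is `c' · f^i` with `i ≤ k`, `c' ≠ 0`. [folklore] -/
theorem eq_C_mul_pow_of_dvd {f a : MvPolynomial σ ℂ} (hf : Prime f) {c : ℂ} (hc : c ≠ 0) {k : ℕ}
    (ha : a ∣ C c * f ^ k) : ∃ (i : ℕ) (c' : ℂ), i ≤ k ∧ c' ≠ 0 ∧ a = C c' * f ^ i := by
  have ha' : a ∣ f ^ k := by
    have hu : IsUnit (C c : MvPolynomial σ ℂ) := (IsUnit.mk0 c hc).map C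
    rw [mul_comm] at ha
    exact (hu.dvd_mul_right).1 ha
  obtain ⟨i, hik, u, hu⟩ := (dvd_prime_pow hf k).1 ha'
  -- `a * u = f ^ i`, `u` a unit, hence constant
  obtain ⟨r, hr, hur⟩ := MvPolynomial.isUnit_iff_eq_C_of_isReduced.1 (u⁻¹).isUnit
  refine ⟨i, r, hik, hr.ne_zero, ?_⟩
  calc a = a * u * (↑u⁻¹ : MvPolynomial σ ℂ) := by rw [mul_assoc, Units.mul_inv, mul_one]
    _ = C r * f ^ i := by rw [hu, hur, mul_comm]

/-- **Fitting for prime-power determinants.**  Let `f ∈ ℂ[x_σ]` be prime.  Every affine `M ∈ M_m(ℂ[x_σ])` with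
`det M = c · f^k`, `c ≠ 0`, `k ≥ 1`, has an affine retract `N ∈ M_{k'}(ℂ[x_σ])`, `k' ≤ m`, with
`det N = c' · f^j`, `c' ≠ 0`, `1 ≤ j ≤ k`, through complex matrices `v_W, v_V, u_W, u_V` (`v_W N = M v_V`,
`u_W M = N u_V`, `u_W v_W = 1 = u_V v_V`), such that `N` is LOCAL: for every `g, h ∈ M_{k'}(ℂ)` with `g N = N h`
there is `μ ∈ ℂ` with `g − μ` and `h − μ` nilpotent. [folklore] -/
theorem exists_local_retract_pow {f : MvPolynomial σ ℂ} (hf : Prime f) (m : ℕ) :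
    ∀ (k : ℕ) (M : Matrix (Fin m) (Fin m) (MvPolynomial σ ℂ)) (c : ℂ), 1 ≤ k → c ≠ 0 →
      (∀ i j, (M i j).totalDegree ≤ 1) → M.det = C c * f ^ k →
      ∃ (j k' : ℕ) (N : Matrix (Fin k') (Fin k') (MvPolynomial σ ℂ)) (c' : ℂ)
        (vW vV : Matrix (Fin m) (Fin k') ℂ) (uW uV : Matrix (Fin k') (Fin m) ℂ),
        1 ≤ j ∧ j ≤ k ∧ k' ≤ m ∧ c' ≠ 0 ∧ (∀ i j, (N i j).totalDegree ≤ 1) ∧ N.det = C c' * f ^ j ∧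
        (∀ g h : Matrix (Fin k') (Fin k') ℂ, g.map C * N = N * h.map C →
          ∃ μ : ℂ, IsNilpotent (g - μ • (1 : Matrix (Fin k') (Fin k') ℂ)) ∧
            IsNilpotent (h - μ • (1 : Matrix (Fin k') (Fin k') ℂ))) ∧
        vW.map (C (σ := σ)) * N = M * vV.map (C (σ := σ)) ∧
        uW.map (C (σ := σ)) * M = N * uV.map (C (σ := σ)) ∧ uW * vW = 1 ∧ uV * vV = 1 := by
  classical
  induction m using Nat.strong_induction_on with
  | _ m ih =>
  intro k M c hk hc haff hdet
  by_cases hloc : ∀ g h : Matrix (Fin m) (Fin m) ℂ, g.map C * M = M * h.map C →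
      ∃ μ : ℂ, IsNilpotent (g - μ • (1 : Matrix (Fin m) (Fin m) ℂ)) ∧ IsNilpotent (h - μ • (1 : Matrix (Fin m) (Fin m) ℂ))
  · -- `M` itself is local
    refine ⟨k, m, M, c, 1, 1, 1, 1, hk, le_rfl, le_rfl, hc, haff, hdet, hloc, ?_, ?_, Matrix.mul_one _,
      Matrix.mul_one _⟩
    · rw [Matrix.map_one C C_0 C_1, Matrix.one_mul, Matrix.mul_one]
    · rw [Matrix.map_one C C_0 C_1, Matrix.one_mul, Matrix.mul_one]
  · -- a non-local endomorphism pair splits `M`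
    push Not at hloc
    obtain ⟨g, h, hgh, hnl⟩ := hloc
    have hf0 : f ≠ 0 := hf.ne_zero
    have hCc : (C c : MvPolynomial σ ℂ) ≠ 0 := fun h0 => hc (C_eq_zero.1 h0)
    have hM : M.det ≠ 0 := by rw [hdet]; exact mul_ne_zero hCc (pow_ne_zero _ hf0)
    obtain ⟨P, Q, β, hvan, hβg, hβh, -, -⟩ := exists_gradedSquareForm M hM g h hgh
    -- `m ≥ 1`
    have hm : 0 < m := by
      rcases Nat.eq_zero_or_pos m with h0 | h0
      · exfalso
        subst h0
        have h1 : M.det = 1 := Matrix.det_isEmpty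
        rw [h1] at hdet
        have h2 : IsUnit (f ^ k) := IsUnit.of_mul_eq_one_right _ hdet.symm
        exact hf.not_unit ((isUnit_pow_iff (by omega)).1 h2)
      · exact h0
    set i₀ : Fin m := ⟨0, hm⟩ with hi₀
    set μ : ℂ := β i₀ with hμ
    let p : Fin m → Prop := fun i => β i = μ
    have hp₀ : p i₀ := rfl
    have hnot : ∃ j, ¬ p j := by
      by_contra hall
      push Not at hall
      have hcardm : (univ.filter fun i => β i = μ).card = m := by
        rw [Finset.filter_true_of_mem fun i _ => hall i, card_univ, Fintype.card_fin]
      apply hnl μ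
      · exact isNilpotent_sub_of_finrank_maxGen_eq g μ ((hβg μ).symm.trans hcardm)
      · exact isNilpotent_sub_of_finrank_maxGen_eq h μ ((hβh μ).symm.trans hcardm)
    set Pm : Matrix (Fin m) (Fin m) ℂ := (P : Matrix (Fin m) (Fin m) ℂ) with hPm
    set Pi : Matrix (Fin m) (Fin m) ℂ := ((P⁻¹ : GL (Fin m) ℂ) : Matrix (Fin m) (Fin m) ℂ) with hPi
    set Qm : Matrix (Fin m) (Fin m) ℂ := (Q : Matrix (Fin m) (Fin m) ℂ) with hQm
    set Qi : Matrix (Fin m) (Fin m) ℂ := ((Q⁻¹ : GL (Fin m) ℂ) : Matrix (Fin m) (Fin m) ℂ) with hQi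
    have hPiP : Pi * Pm = 1 := by rw [hPi, hPm, ← Units.val_mul, inv_mul_cancel, Units.val_one]
    have hPPi : Pm * Pi = 1 := by rw [hPi, hPm, ← Units.val_mul, mul_inv_cancel, Units.val_one]
    have hQQi : Qm * Qi = 1 := by rw [hQi, hQm, ← Units.val_mul, mul_inv_cancel, Units.val_one]
    have hQiQ : Qi * Qm = 1 := by rw [hQi, hQm, ← Units.val_mul, inv_mul_cancel, Units.val_one]
    set M' : Matrix (Fin m) (Fin m) (MvPolynomial σ ℂ) := Pm.map C * M * Qm.map C with hM'
    have haff' : ∀ i j, (M' i j).totalDegree ≤ 1 := totalDegree_map_C_mul_mul_map_C_le Pm Qm haff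
    have hPdet : Pm.det ≠ 0 := by
      have h1 := congrArg Matrix.det hPPi
      rw [Matrix.det_mul, Matrix.det_one] at h1
      exact left_ne_zero_of_mul_eq_one h1
    have hQdet : Qm.det ≠ 0 := by
      have h1 := congrArg Matrix.det hQQi
      rw [Matrix.det_mul, Matrix.det_one] at h1
      exact left_ne_zero_of_mul_eq_one h1
    have hdet' : M'.det = C (Pm.det * Qm.det * c) * f ^ k := by
      rw [hM', det_map_C_mul_mul_map_C, hdet]; simp only [map_mul]; ring
    have hc₁ : Pm.det * Qm.det * c ≠ 0 := mul_ne_zero (mul_ne_zero hPdet hQdet) hc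
    have hisoV : Pi.map (C (σ := σ)) * M' = M * Qm.map (C (σ := σ)) := by
      rw [hM', ← Matrix.mul_assoc, ← Matrix.mul_assoc, ← Matrix.map_mul, hPiP, Matrix.map_one C C_0 C_1,
        Matrix.one_mul]
    have hisoU : Pm.map (C (σ := σ)) * M = M' * Qi.map (C (σ := σ)) := by
      rw [hM', Matrix.mul_assoc, Matrix.mul_assoc, ← Matrix.map_mul, hQQi, Matrix.map_one C C_0 C_1,
        Matrix.mul_one]
    -- the generic block step, for a colouring `q` whose block carries `f ^ i`, `1 ≤ i ≤ k`
    have step : ∀ (q : Fin m → Prop) [DecidablePred q], (∀ i j, q i → ¬ q j → M' i j = 0) →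
        (∀ i j, ¬ q i → q j → M' i j = 0) → (∃ j, ¬ q j) →
        ∀ (i : ℕ) (c₂ : ℂ), 1 ≤ i → i ≤ k → c₂ ≠ 0 → (M'.toSquareBlockProp q).det = C c₂ * f ^ i →
        ∃ (j k' : ℕ) (N : Matrix (Fin k') (Fin k') (MvPolynomial σ ℂ)) (c' : ℂ)
          (vW vV : Matrix (Fin m) (Fin k') ℂ) (uW uV : Matrix (Fin k') (Fin m) ℂ),
          1 ≤ j ∧ j ≤ k ∧ k' ≤ m ∧ c' ≠ 0 ∧ (∀ i j, (N i j).totalDegree ≤ 1) ∧ N.det = C c' * f ^ j ∧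
          (∀ g h : Matrix (Fin k') (Fin k') ℂ, g.map C * N = N * h.map C →
            ∃ μ : ℂ, IsNilpotent (g - μ • (1 : Matrix (Fin k') (Fin k') ℂ)) ∧
              IsNilpotent (h - μ • (1 : Matrix (Fin k') (Fin k') ℂ))) ∧
          vW.map (C (σ := σ)) * N = M * vV.map (C (σ := σ)) ∧
          uW.map (C (σ := σ)) * M = N * uV.map (C (σ := σ)) ∧ uW * vW = 1 ∧ uV * vV = 1 := by
      intro q _ hq₁ hq₂ hqne i c₂ hi1 hik hc₂ hdetq
      obtain ⟨j₀, hj₀⟩ := hqne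
      set k₁ := Fintype.card {i // q i} with hk₁
      have hk₁m : k₁ < m := by
        have := Fintype.card_subtype_lt (p := q) hj₀
        rwa [Fintype.card_fin] at this
      obtain ⟨e₁⟩ : Nonempty ({i // q i} ≃ Fin k₁) := ⟨Fintype.equivFin {i // q i}⟩
      obtain ⟨J, Jt, hJ, hJt, hJtJ, -⟩ := block_retract M' q hq₁ hq₂ e₁
      set N₁ : Matrix (Fin k₁) (Fin k₁) (MvPolynomial σ ℂ) := (M'.toSquareBlockProp q).submatrix e₁.symm e₁.symm
        with hN₁
      have haff₁ : ∀ a b, (N₁ a b).totalDegree ≤ 1 := fun a b => by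
        rw [hN₁, Matrix.submatrix_apply, Matrix.toSquareBlockProp_def, Matrix.of_apply]; exact haff' _ _
      have hdet₁ : N₁.det = C c₂ * f ^ i := by
        rw [hN₁, Matrix.det_submatrix_equiv_self]; exact hdetq
      obtain ⟨j, k', N, c', v₁W, v₁V, u₁W, u₁V, hj1, hji, hk', hc', haffN, hdetN, hlocN, hv₁, hu₁, huv₁W, huv₁V⟩ :=
        ih k₁ hk₁m i N₁ c₂ hi1 hc₂ haff₁ hdet₁
      refine ⟨j, k', N, c', Pi * (J * v₁W), Qm * (J * v₁V), (u₁W * Jt) * Pm, (u₁V * Jt) * Qi,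
        hj1, hji.trans hik, hk'.trans hk₁m.le, hc', haffN, hdetN, hlocN, ?_, ?_, ?_, ?_⟩
      · exact hom_comp (hom_comp hv₁ hJ) hisoV
      · exact hom_comp hisoU (hom_comp hJt hu₁)
      · calc u₁W * Jt * Pm * (Pi * (J * v₁W)) = u₁W * (Jt * ((Pm * Pi) * (J * v₁W))) := by
              simp only [Matrix.mul_assoc]
          _ = 1 := by rw [hPPi, Matrix.one_mul, ← Matrix.mul_assoc Jt, hJtJ, Matrix.one_mul, huv₁W]
      · calc u₁V * Jt * Qi * (Qm * (J * v₁V)) = u₁V * (Jt * ((Qi * Qm) * (J * v₁V))) := by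
              simp only [Matrix.mul_assoc]
          _ = 1 := by rw [hQiQ, Matrix.one_mul, ← Matrix.mul_assoc Jt, hJtJ, Matrix.one_mul, huv₁V]
    -- which block carries a positive power of `f`?
    have hsplit : M'.det = (M'.toSquareBlockProp p).det * (M'.toSquareBlockProp fun i => ¬ p i).det :=
      det_eq_mul_of_graded M' β hvan p fun i j hi hj hij => hj (hij.symm.trans hi)
    have hprod : (M'.toSquareBlockProp p).det * (M'.toSquareBlockProp fun i => ¬ p i).det =
        C (Pm.det * Qm.det * c) * f ^ k := hsplit.symm.trans hdet'
    obtain ⟨i, c₂, hik, hc₂, hdetp⟩ := eq_C_mul_pow_of_dvd hf hc₁ (Dvd.intro _ hprod)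
    rcases Nat.eq_zero_or_pos i with hi0 | hi0
    · -- the `p`-block is a unit: the `¬ p`-block carries all of `f ^ k`
      rw [hi0, pow_zero, mul_one] at hdetp
      have hunit : IsUnit (M'.toSquareBlockProp p).det := by rw [hdetp]; exact (IsUnit.mk0 c₂ hc₂).map C
      have hprod' : (M'.toSquareBlockProp fun i => ¬ p i).det * (M'.toSquareBlockProp p).det =
          C (Pm.det * Qm.det * c) * f ^ k := by rw [mul_comm]; exact hprod
      obtain ⟨c₃, hc₃, hdetn⟩ := eq_C_mul_of_mul_eq_C_mul_of_isUnit hc₁ hprod' hunit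
      refine step (fun i => ¬ p i) (fun i j hi hj => hvan i j fun hij => hi ?_)
        (fun i j hi hj => hvan i j fun hij => hj ?_) ⟨i₀, fun h => h hp₀⟩ k c₃ hk le_rfl hc₃ ?_
      · exact hij.trans (not_not.1 hj)
      · exact hij.symm.trans (not_not.1 hi)
      · exact hdetn
    · -- the `p`-block carries `f ^ i`, `1 ≤ i ≤ k`
      exact step p (fun i j hi hj => hvan i j fun hij => hj (hij.symm.trans hi))
        (fun i j hi hj => hvan i j fun hij => hi (hij.trans hj)) hnot i c₂ hi0 hik hc₂ hdetp

end Pow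

end Summit.ValiantsHypothesis.ValiantsHypothesis.Theorems.FreeSubtorusOrbitDimensionBound.SquareCovering
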